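import Literature.AlgebraicGeometry.Motives.HodgeStructure

/-!
# The Hodge decomposition of a pure `ℚ`-Hodge structure (proofs)

This file discharges the three named facts of
`Literature/AlgebraicGeometry/Motives/HodgeStructure.lean` that make up the Hodge decomposition
of a pure `ℚ`-Hodge structure `H : HodgeStructure V n` given in filtration form
(`V^{p,q} := F^p ∩ conj F^q` for `p + q = n`, `HodgeStructure.piece`):

* `Literature.HodgeStructure.iSupIndep_piece_holds : iSupIndep_piece` — the pieces `V^{p,n-p}` are
  independent;
* `Literature.HodgeStructure.F_eq_iSup_piece_holds : F_eq_iSup_piece` — `F^p = ⊕_{i ≥ p} V^{i,n-i}`;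
* `Literature.HodgeStructure.iSup_piece_eq_top_holds : iSup_piece_eq_top` — `V_ℂ = ⊕_p V^{p,n-p}`.

Source: P. Deligne, *Théorie de Hodge II*, Publ. Math. IHÉS 40 (1971), Prop. 1.2.5: two finite
filtrations `F`, `F̄` of an object `A` are `n`-opposed iff `F^p ⊕ F̄^q = A` for all `p + q = n + 1`,
and then `A = ⊕_{p+q=n} A^{p,q}` with `A^{p,q} = F^p ∩ F̄^q`, `F^p = ⊕_{i ≥ p} A^{i,n-i}`; as
reproduced in E. Cattani, F. El Zein, P. Griffiths, Lê D. T., *Hodge Theory* (Princeton Math.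
Notes 49, 2014), Prop. 3.2.10 (i)–(ii) and Def. 3.2.12 (p. 156: "`F^p = ⊕_{i ≥ p} H^{i,n-i}`,
`F̄^q = ⊕_{i ≤ n-q} H^{i,n-i}`").

## Proof

Everything follows lattice-theoretically from the opposedness axiom
`isCompl_F_complexConj : p + q = n + 1 → F^p ⊕ conj F^q = V_ℂ` and the finiteness of `F`; no
finite-dimensionality of `V` is used.

* `F_eq_F_succ_sup_piece`: `F^p = F^{p+1} + V^{p,n-p}`: for `x ∈ F^p` write `x = y + z` with
  `y ∈ F^{p+1}`, `z ∈ conj F^{n-p}` (opposedness at `(p+1, n-p)`); then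
  `z = x - y ∈ F^p ∩ conj F^{n-p} = V^{p,n-p}`.
* `piece_inf_F_succ_sup_complexConj_eq_bot`: `V^{p,n-p} ∩ (F^{p+1} + conj F^{n-p+1}) = 0`, from the
  opposedness relations at `(p, n-p+1)` and `(p+1, n-p)`. Since `V^{i,n-i} ⊆ F^{p+1}` for `i > p`
  and `V^{i,n-i} ⊆ conj F^{n-p+1}` for `i < p`, this gives the independence of the pieces.
* Iterating the first identity, `F^p ⊆ F^{p+k} + Σ_{i ≥ p} V^{i,n-i}` for all `k`
  (`F_le_F_add_sup_iSup_piece`); with `F^{p+k} = 0` for `k ≫ 0` this is `F^p = Σ_{i ≥ p} V^{i,n-i}`,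
  and with `F^p = V_ℂ` for `p ≪ 0` it is `V_ℂ = Σ_p V^{p,n-p}`.

## References

* P. Deligne, *Théorie de Hodge II*, Publ. Math. IHÉS 40 (1971), 5–57, §1.2.4–1.2.5.
* E. Cattani, F. El Zein, P. A. Griffiths, Lê D. T. (eds.), *Hodge Theory*, Princeton
  Mathematical Notes 49 (2014), §3.2.1.9–3.2.1.10, Prop. 3.2.10, Def. 3.2.12.
-/

open scoped TensorProduct

noncomputable section

namespace Literature.AlgebraicGeometry.Motives

namespace HodgeStructure

universe u

variable {V : Type u} [AddCommGroup V] [Module ℚ V] {n : ℤ}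

/-- One step of the Hodge decomposition: `F^p = F^{p+1} + V^{p,n-p}` (the sum is direct by
opposedness at `(p+1, n-p)`): given `x ∈ F^p`, write `x = y + z` with `y ∈ F^{p+1}`,
`z ∈ conj F^{n-p}` (opposedness at `(p+1, n-p)`); then `z = x - y ∈ F^p ∩ conj F^{n-p} = V^{p,n-p}`
(Deligne, *Théorie de Hodge II*, Prop. 1.2.5; Cattani–El Zein–Griffiths–Lê, *Hodge Theory*,
Prop. 3.2.10). [cite: DeligneHodgeII1971, 1.2.5]
[cite: CattaniElZeinGriffithsLe2014, Prop. 3.2.10] -/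
theorem F_eq_F_succ_sup_piece (H : HodgeStructure V n) (p : ℤ) :
    H.F p = H.F (p + 1) ⊔ H.piece p (n - p) := by
  apply le_antisymm
  · intro x hx
    have hc := (H.isCompl_F_complexConj (p + 1) (n - p) (by ring)).sup_eq_top
    have hx' : x ∈ H.F (p + 1) ⊔ complexConj (H.F (n - p)) := by rw [hc]; trivial
    obtain ⟨y, hy, z, hz, rfl⟩ := Submodule.mem_sup.1 hx'
    refine Submodule.mem_sup.2 ⟨y, hy, z, ?_, rfl⟩
    rw [mem_piece_iff H (by ring)]
    refine ⟨?_, hz⟩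
    have : z = (y + z) - y := by abel
    rw [this]
    exact Submodule.sub_mem _ hx (H.antitone_F (by omega) hy)
  · exact sup_le (H.antitone_F (by omega)) (piece_le_F H p (n - p))

/-- The piece `V^{p,n-p}` meets `F^{p+1} + conj F^{n-p+1}` trivially: if `x = y + z ∈ V^{p,n-p}`
with `y ∈ F^{p+1}`, `z ∈ conj F^{n-p+1}`, then `z = x - y ∈ F^p ∩ conj F^{n-p+1} = 0` and then
`x = y ∈ F^{p+1} ∩ conj F^{n-p} = 0` (the opposedness relations at `(p, n-p+1)` and `(p+1, n-p)`;
Deligne, *Théorie de Hodge II*, Prop. 1.2.5). [cite: DeligneHodgeII1971, 1.2.5]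
[cite: CattaniElZeinGriffithsLe2014, Prop. 3.2.10] -/
theorem piece_inf_F_succ_sup_complexConj_eq_bot (H : HodgeStructure V n) (p : ℤ) :
    H.piece p (n - p) ⊓ (H.F (p + 1) ⊔ complexConj (H.F (n - p + 1))) = ⊥ := by
  rw [eq_bot_iff]
  rintro x ⟨hx, hx'⟩
  rw [SetLike.mem_coe, mem_piece_iff H (by ring)] at hx
  obtain ⟨y, hy, z, hz, rfl⟩ := Submodule.mem_sup.1 hx'
  have h1 : Disjoint (H.F p) (complexConj (H.F (n - p + 1))) :=
    (H.isCompl_F_complexConj p (n - p + 1) (by ring)).disjoint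
  have hzF : z ∈ H.F p := by
    have : z = (y + z) - y := by abel
    rw [this]
    exact Submodule.sub_mem _ hx.1 (H.antitone_F (by omega) hy)
  have hz0 : z = 0 := (Submodule.disjoint_def.1 h1) z hzF hz
  subst hz0
  have h2 : Disjoint (H.F (p + 1)) (complexConj (H.F (n - p))) :=
    (H.isCompl_F_complexConj (p + 1) (n - p) (by ring)).disjoint
  rw [add_zero] at hx ⊢
  rw [Submodule.mem_bot]
  exact (Submodule.disjoint_def.1 h2) y hy hx.2

/-- **Hodge decomposition, independence** (discharges the named fact `iSupIndep_piece`): the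
pieces `V^{p,n-p}` are independent. For `i < p`, `V^{i,n-i} ⊆ conj F^{n-i} ⊆ conj F^{n-p+1}`; for
`i > p`, `V^{i,n-i} ⊆ F^i ⊆ F^{p+1}`; and `V^{p,n-p} ∩ (F^{p+1} + conj F^{n-p+1}) = 0`
(`piece_inf_F_succ_sup_complexConj_eq_bot`). Source: Deligne, *Théorie de Hodge II*, Prop. 1.2.5
(`F`, `conj F` `n`-opposed ⇒ `A = ⊕ A^{p,q}`); Cattani–El Zein–Griffiths–Lê, *Hodge Theory*,
Prop. 3.2.10 (ii). No finite-dimensionality is needed. [cite: DeligneHodgeII1971, 1.2.5]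
[cite: CattaniElZeinGriffithsLe2014, Prop. 3.2.10] -/
theorem iSupIndep_piece_holds : iSupIndep_piece (V := V) (n := n) := by
  intro H
  rw [iSupIndep_def]
  intro p
  rw [disjoint_iff, ← le_bot_iff, ← piece_inf_F_succ_sup_complexConj_eq_bot H p]
  refine inf_le_inf_left _ (iSup₂_le fun i hi => ?_)
  rcases lt_or_gt_of_ne hi with h | h
  · exact le_sup_of_le_right ((piece_le_complexConj_F H i (n - i)).trans
      (complexConj_mono (H.antitone_F (by omega))))
  · exact le_sup_of_le_left ((piece_le_F H i (n - i)).trans (H.antitone_F (by omega)))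

/-- `F^p ⊆ F^{p+k} + Σ_{i ≥ p} V^{i,n-i}` for every `k : ℕ`, by iterating `F_eq_F_succ_sup_piece`
(Deligne, *Théorie de Hodge II*, proof of Prop. 1.2.5). [cite: DeligneHodgeII1971, 1.2.5]
[cite: CattaniElZeinGriffithsLe2014, Prop. 3.2.10] -/
theorem F_le_F_add_sup_iSup_piece (H : HodgeStructure V n) (p : ℤ) (k : ℕ) :
    H.F p ≤ H.F (p + k) ⊔ ⨆ (i : ℤ) (_ : p ≤ i), H.piece i (n - i) := by
  induction k with
  | zero => simp
  | succ k ih =>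
    refine ih.trans (sup_le ?_ le_sup_right)
    rw [F_eq_F_succ_sup_piece H (p + k)]
    refine sup_le ?_ ?_
    · push_cast
      rw [add_assoc]
      exact le_sup_left
    · exact le_sup_of_le_right (le_iSup₂_of_le (p + k) (by omega) le_rfl)

/-- **Hodge decomposition, filtration** (discharges the named fact `F_eq_iSup_piece`):
`F^p = ⊕_{i ≥ p} V^{i,n-i}`. The inclusion `⊆` iterates `F^p = F^{p+1} + V^{p,n-p}` until
`F^{p+k} = 0` (the filtration is finite); `⊇` is `V^{i,n-i} ⊆ F^i ⊆ F^p`. Source: Deligne,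
*Théorie de Hodge II*, Prop. 1.2.5 and 1.2.4 (`F^p = ⊕_{i ≥ p} A^{i,n-i}`); Cattani–El Zein–
Griffiths–Lê, *Hodge Theory*, Def. 3.2.12. [cite: DeligneHodgeII1971, 1.2.5]
[cite: CattaniElZeinGriffithsLe2014, Prop. 3.2.10] -/
theorem F_eq_iSup_piece_holds : F_eq_iSup_piece (V := V) (n := n) := by
  intro H p
  apply le_antisymm
  · obtain ⟨N, hN⟩ := H.exists_F_eq_bot
    have key := F_le_F_add_sup_iSup_piece H p (N - p).toNat
    have hle : N ≤ p + ((N - p).toNat : ℤ) := by omega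
    have hbot : H.F (p + (N - p).toNat) = ⊥ := eq_bot_iff.2 (hN ▸ H.antitone_F hle)
    rwa [hbot, bot_sup_eq] at key
  · exact iSup₂_le fun i hi => (piece_le_F H i (n - i)).trans (H.antitone_F hi)

/-- **Hodge decomposition, exhaustion** (discharges the named fact `iSup_piece_eq_top`):
`V_ℂ = Σ_p V^{p,n-p}`: take `p` with `F^p = V_ℂ` in `F_eq_iSup_piece_holds`. Source: Deligne,
*Théorie de Hodge II*, Prop. 1.2.5; Cattani–El Zein–Griffiths–Lê, *Hodge Theory*,
Prop. 3.2.10 (ii). [cite: DeligneHodgeII1971, 1.2.5]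
[cite: CattaniElZeinGriffithsLe2014, Prop. 3.2.10] -/
theorem iSup_piece_eq_top_holds : iSup_piece_eq_top (V := V) (n := n) := by
  intro H
  obtain ⟨p, hp⟩ := H.exists_F_eq_top
  rw [eq_top_iff, ← hp, F_eq_iSup_piece_holds H p]
  exact iSup₂_le fun i _ => le_iSup (fun i => H.piece i (n - i)) i


end HodgeStructure

end Literature.AlgebraicGeometry.Motives

end
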